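import Summits.Ventures.Crystal3D.Theorems.StickyWulffConstantTextureLiminfLineCountGlueOneSidedUp
import HarnessLib

/-!
# The covered wall cell from a TWO-family line count along CHOSEN-SLOT (`IsUpBond`) step sequences — T-side of EDGE-ON option (ε₂)
# (lane T, crux `TextureLiminfV5`, stmt-Ventures-23912, sub-crux EDGE-ON `stub_edgeOn`; cf-p1 Q-ε₂ (cxvii)(2), 19480-p2 g12)

HONEST FRAMING. Venture `Summits/Ventures/Crystal3D` (cell `crystal3d-full`), route `route-Ventures-StickyWulffConstant`, helper
`--supports` the law-v5 crux `TextureLiminfV5` (stmt-Ventures-23912).  Bookkeeping only, standard axioms; nothing about any wall law is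
claimed beyond the stated implications; rung F-C1 not moved.

WHAT.  wulff-p2's two-family glue `bilayerWallAt_of_lineCount` (…LineCountGlue) consumes the CANONICAL selectors (`IsZigSelector`, `FluxDominated`);
the one-family chosen-slot glue `bilayerWallAt_of_lineCount_oneSided_up[_top]` (…LineCountGlueOneSidedUp) consumes an `IsUpBond` step sequence of ONE plate
with the other plate's flux set to `0`.  Lane G's two-sided STEERED ledger (`barlow_hlines_oriented_apart_at_tiltWide`, 19480-p2 g12 G3) returns TWO
`IsUpBond` step sequences (plate 1 up along `e₃`, plate 2 up along `−e₃`, every step rising `≥ 1/4`) and ONE two-family line count per cell.  This file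
is the missing two-family `IsUpBond` glue — `charge_le_flux` with BOTH plates' fluxes `√2·⟪step₁ i, L₁⁻¹e₃⟫`, `√2·⟪step₂ j, L₂⁻¹(−e₃)⟫` and
`plate_lines_ge_flux_up` on both plates:
* `two_charge_le_lines_inner_up₂` — slice charge `2Q(wallSlice ρ') ≤ #T₁ + #T₂` for tables with
  `c i j ≤ √2·(⟪step₁ i, L₁⁻¹e₃⟫ + ⟪step₂ j, L₂⁻¹(−e₃)⟫)/2` (the TWO-SIDED flux sum — the point of (ε₂));
* `cell_charge_le_lines_margin_up₂` — `2Q(wallSlice ρ) ≤ #T₁ + #T₂ + 80(R₀+9)(1+h)ρ + 18mρ`;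
* **`bilayerWallAt_of_lineCount_up₂`** — the G3 deliverable shape ⇒ `BilayerWallAt ((C_w + 80(R₀+9) + 3456 + 1152(R₀+1))/2) R₀ σ₁ σ₂ L₁ L₂ s₁ s₂ c`.
WHAT THIS IS NOT: no proof of any wall law or of any registered stub; no certificate; F-C1 not moved.
-/

noncomputable section

namespace Summit.Ventures.Crystal3D.Theorems

open MeasureTheory Set
open scoped ENNReal InnerProductSpace
open Literature.MathematicalPhysics.StatisticalMechanics (IsHaggSeq triangularVec₁ triangularVec₂ fccStacking)
open Summit.Ventures.Crystal3D.Cruxes.TextureLiminf.TexShadow (E3 e₃ cyl stacking laySlab bilayerRise BilayerWallAt)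

/-! ## The inner two-family flux count along two `IsUpBond` step sequences -/

/-- **Inner TWO-family flux count, chosen steps.**  Plate 1 up-presented along `e₃` (`0 ≤ (L₁⁻¹e₃)₂`) with steps `step₁`, plate 2 up-presented
along `−e₃` (`0 ≤ (L₂⁻¹(−e₃))₂`) with steps `step₂`, all rises `≥ 1/4`; a table with `c i j ≤ √2·(⟪step₁ i, L₁⁻¹e₃⟫ + ⟪step₂ j, L₂⁻¹(−e₃)⟫)/2` has
slice charge `2Q(wallSlice ρ') ≤ #T₁ + #T₂` for every finite `T₁ ⊇` the plate-1 polyline lines through `[-R₀-4, -R₀-3] × {lateral ≤ ρ' + 4R₀ + 36}` and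
`T₂ ⊇` the plate-2 polyline lines through `[h+R₀+3, h+R₀+4] × {lateral ≤ ρ' + 4h + 4R₀ + 36}`. -/
theorem two_charge_le_lines_inner_up₂ {σ₁ σ₂ : ℤ → ℤ} (hσ₁ : IsHaggSeq σ₁) (hσ₂ : IsHaggSeq σ₂)
    (L₁ L₂ : E3 ≃ₗᵢ[ℝ] E3) (s₁ s₂ : E3) (R₀ h ρ' : ℝ) (hR₀ : 1 ≤ R₀) (hh : 0 ≤ h) (hρ' : 0 ≤ ρ')
    (hax₁ : 0 ≤ (L₁.symm e₃) 2) (hax₂ : 0 ≤ (L₂.symm (-e₃)) 2)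
    {step₁ : ℤ → E3} (hup₁ : ∀ k : ℤ, IsUpBond L₁ σ₁ e₃ k (step₁ k)) (hr₁ : ∀ k : ℤ, (1 / 4 : ℝ) ≤ ⟪step₁ k, L₁.symm e₃⟫_ℝ)
    {step₂ : ℤ → E3} (hup₂ : ∀ k : ℤ, IsUpBond L₂ σ₂ (-e₃) k (step₂ k)) (hr₂ : ∀ k : ℤ, (1 / 4 : ℝ) ≤ ⟪step₂ k, L₂.symm (-e₃)⟫_ℝ)
    (c : ℤ → ℤ → ℝ) (hc0 : ∀ i j, 0 ≤ c i j)
    (hdom : ∀ i j, c i j ≤ Real.sqrt 2 * (⟪step₁ i, L₁.symm e₃⟫_ℝ + ⟪step₂ j, L₂.symm (-e₃)⟫_ℝ) / 2)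
    (T₁ T₂ : Finset (Fin 2 → ℤ))
    (hT₁ : ∀ t : Fin 2 → ℤ, (∃ k : ℤ,
        -R₀ - 4 ≤ (L₁ (zigVertexS step₁ k + ((t 0 : ℝ) • triangularVec₁ 1 + (t 1 : ℝ) • triangularVec₂ 1)) + s₁) 2 ∧
        (L₁ (zigVertexS step₁ k + ((t 0 : ℝ) • triangularVec₁ 1 + (t 1 : ℝ) • triangularVec₂ 1)) + s₁) 2 ≤ -R₀ - 3 ∧
        Real.sqrt ((L₁ (zigVertexS step₁ k + ((t 0 : ℝ) • triangularVec₁ 1 + (t 1 : ℝ) • triangularVec₂ 1)) + s₁) 0 ^ 2 +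
          (L₁ (zigVertexS step₁ k + ((t 0 : ℝ) • triangularVec₁ 1 + (t 1 : ℝ) • triangularVec₂ 1)) + s₁) 1 ^ 2) ≤
          ρ' + 4 * R₀ + 36) → t ∈ T₁)
    (hT₂ : ∀ t : Fin 2 → ℤ, (∃ k : ℤ,
        h + R₀ + 3 ≤ (L₂ (zigVertexS step₂ k + ((t 0 : ℝ) • triangularVec₁ 1 + (t 1 : ℝ) • triangularVec₂ 1)) + s₂) 2 ∧
        (L₂ (zigVertexS step₂ k + ((t 0 : ℝ) • triangularVec₁ 1 + (t 1 : ℝ) • triangularVec₂ 1)) + s₂) 2 ≤ h + R₀ + 4 ∧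
        Real.sqrt ((L₂ (zigVertexS step₂ k + ((t 0 : ℝ) • triangularVec₁ 1 + (t 1 : ℝ) • triangularVec₂ 1)) + s₂) 0 ^ 2 +
          (L₂ (zigVertexS step₂ k + ((t 0 : ℝ) • triangularVec₁ 1 + (t 1 : ℝ) • triangularVec₂ 1)) + s₂) 1 ^ 2) ≤
          ρ' + 4 * h + 4 * R₀ + 36) → t ∈ T₂) :
    2 * ∑' ij : ℤ × ℤ, c ij.1 ij.2 * (volume (wallSlice ρ' ∩ laySlab L₁ s₁ ij.1 ∩ laySlab L₂ s₂ ij.2)).toReal ≤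
      (T₁.card : ℝ) + T₂.card := by
  have he₃ : ‖(e₃ : E3)‖ = 1 := by rw [e₃, PiLp.norm_single, norm_one]
  have hne₃ : ‖(-e₃ : E3)‖ = 1 := by rw [norm_neg, he₃]
  have hi₃ : ∀ p : E3, ⟪p, e₃⟫_ℝ = p 2 := fun p => by
    rw [e₃, EuclideanSpace.inner_single_right]; simp
  have hs2 : 0 ≤ Real.sqrt 2 := Real.sqrt_nonneg 2
  have hSfin : volume (wallSlice ρ') ≠ ⊤ := by rw [volume_wallSlice ρ' hρ']; exact ENNReal.ofReal_ne_top
  have hκ₁0 : ∀ i, 0 ≤ Real.sqrt 2 * ⟪step₁ i, L₁.symm e₃⟫_ℝ := fun i =>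
    mul_nonneg hs2 (le_trans (by norm_num) (hr₁ i))
  have hκ₁B : ∀ i, Real.sqrt 2 * ⟪step₁ i, L₁.symm e₃⟫_ℝ ≤ Real.sqrt 2 := fun i =>
    mul_le_of_le_one_right hs2 ((real_inner_le_norm _ _).trans
      (by rw [(hup₁ i).norm_eq_one, LinearIsometryEquiv.norm_map, he₃, one_mul]))
  have hκ₂0 : ∀ j, 0 ≤ Real.sqrt 2 * ⟪step₂ j, L₂.symm (-e₃)⟫_ℝ := fun j =>
    mul_nonneg hs2 (le_trans (by norm_num) (hr₂ j))
  have hκ₂B : ∀ j, Real.sqrt 2 * ⟪step₂ j, L₂.symm (-e₃)⟫_ℝ ≤ Real.sqrt 2 := fun j =>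
    mul_le_of_le_one_right hs2 ((real_inner_le_norm _ _).trans
      (by rw [(hup₂ j).norm_eq_one, LinearIsometryEquiv.norm_map, hne₃, one_mul]))
  have hdomκ : ∀ i j, c i j ≤ (Real.sqrt 2 * ⟪step₁ i, L₁.symm e₃⟫_ℝ + Real.sqrt 2 * ⟪step₂ j, L₂.symm (-e₃)⟫_ℝ) / 2 :=
    fun i j => by rw [← mul_add]; exact hdom i j
  have hflux := charge_le_flux L₁ L₂ s₁ s₂ (fun i => Real.sqrt 2 * ⟪step₁ i, L₁.symm e₃⟫_ℝ)
    (fun j => Real.sqrt 2 * ⟪step₂ j, L₂.symm (-e₃)⟫_ℝ) c (Real.sqrt 2) hκ₁0 hκ₁B hκ₂0 hκ₂B hc0 hdomκ (wallSlice ρ')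
    (measurableSet_wallSlice ρ') hSfin
  -- plate 1
  have hsub₁ : wallSlice ρ' ⊆ {p : E3 | (0 : ℝ) ≤ ⟪p, e₃⟫_ℝ ∧ ⟪p, e₃⟫_ℝ ≤ 0 + 1 ∧ Real.sqrt (p 0 ^ 2 + p 1 ^ 2) ≤ ρ'} := by
    rintro p ⟨h1, h2, h3⟩
    refine ⟨by rw [hi₃]; exact h1, by rw [hi₃]; linarith, ?_⟩
    rw [← Real.sqrt_sq hρ']; exact Real.sqrt_le_sqrt h3
  have hP₁ := plate_lines_ge_flux_up hσ₁ L₁ s₁ e₃ he₃ hax₁ hup₁ hr₁ ρ' 0 (-R₀ - 4) (by linarith) (wallSlice ρ')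
    (measurableSet_wallSlice ρ') hSfin hsub₁ T₁
    (fun t ⟨k, hk1, hk2, hk3⟩ => hT₁ t ⟨k, by rw [hi₃] at hk1; linarith, by rw [hi₃] at hk2; linarith,
      hk3.trans (by linarith)⟩)
  -- plate 2
  have hsub₂ : wallSlice ρ' ⊆ {p : E3 | (-1 : ℝ) ≤ ⟪p, -e₃⟫_ℝ ∧ ⟪p, -e₃⟫_ℝ ≤ -1 + 1 ∧ Real.sqrt (p 0 ^ 2 + p 1 ^ 2) ≤ ρ'} := by
    rintro p ⟨h1, h2, h3⟩
    refine ⟨by rw [inner_neg_right, hi₃]; linarith, by rw [inner_neg_right, hi₃]; linarith, ?_⟩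
    rw [← Real.sqrt_sq hρ']; exact Real.sqrt_le_sqrt h3
  have hP₂ := plate_lines_ge_flux_up hσ₂ L₂ s₂ (-e₃) hne₃ hax₂ hup₂ hr₂ ρ' (-1) (-h - R₀ - 4) (by linarith) (wallSlice ρ')
    (measurableSet_wallSlice ρ') hSfin hsub₂ T₂
    (fun t ⟨k, hk1, hk2, hk3⟩ => hT₂ t ⟨k, by rw [inner_neg_right, hi₃] at hk2; linarith,
      by rw [inner_neg_right, hi₃] at hk1; linarith, hk3.trans (by linarith)⟩)
  linarith

/-! ## The cell form: rim + margin -/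

/-- **Two-family cell bound along chosen steps, with margin**: `2Q(wallSlice ρ) ≤ #T₁ + #T₂ + 80(R₀+9)(1+h)ρ + 18mρ`. -/
theorem cell_charge_le_lines_margin_up₂ {σ₁ σ₂ : ℤ → ℤ} (hσ₁ : IsHaggSeq σ₁) (hσ₂ : IsHaggSeq σ₂)
    (L₁ L₂ : E3 ≃ₗᵢ[ℝ] E3) (s₁ s₂ : E3) (R₀ h ρ : ℝ) (hR₀ : 1 ≤ R₀) (hh : 0 ≤ h) (hρ : 0 ≤ ρ)
    (hax₁ : 0 ≤ (L₁.symm e₃) 2) (hax₂ : 0 ≤ (L₂.symm (-e₃)) 2)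
    {step₁ : ℤ → E3} (hup₁ : ∀ k : ℤ, IsUpBond L₁ σ₁ e₃ k (step₁ k)) (hr₁ : ∀ k : ℤ, (1 / 4 : ℝ) ≤ ⟪step₁ k, L₁.symm e₃⟫_ℝ)
    {step₂ : ℤ → E3} (hup₂ : ∀ k : ℤ, IsUpBond L₂ σ₂ (-e₃) k (step₂ k)) (hr₂ : ∀ k : ℤ, (1 / 4 : ℝ) ≤ ⟪step₂ k, L₂.symm (-e₃)⟫_ℝ)
    (c : ℤ → ℤ → ℝ) (hc0 : ∀ i j, 0 ≤ c i j)
    (hdom : ∀ i j, c i j ≤ Real.sqrt 2 * (⟪step₁ i, L₁.symm e₃⟫_ℝ + ⟪step₂ j, L₂.symm (-e₃)⟫_ℝ) / 2)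
    (m : ℝ) (hm : 0 ≤ m) (T₁ T₂ : Finset (Fin 2 → ℤ))
    (hT₁ : ∀ t : Fin 2 → ℤ, (∃ k : ℤ,
        -R₀ - 4 ≤ (L₁ (zigVertexS step₁ k + ((t 0 : ℝ) • triangularVec₁ 1 + (t 1 : ℝ) • triangularVec₂ 1)) + s₁) 2 ∧
        (L₁ (zigVertexS step₁ k + ((t 0 : ℝ) • triangularVec₁ 1 + (t 1 : ℝ) • triangularVec₂ 1)) + s₁) 2 ≤ -R₀ - 3 ∧
        Real.sqrt ((L₁ (zigVertexS step₁ k + ((t 0 : ℝ) • triangularVec₁ 1 + (t 1 : ℝ) • triangularVec₂ 1)) + s₁) 0 ^ 2 +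
          (L₁ (zigVertexS step₁ k + ((t 0 : ℝ) • triangularVec₁ 1 + (t 1 : ℝ) • triangularVec₂ 1)) + s₁) 1 ^ 2) ≤ ρ - m) →
        t ∈ T₁)
    (hT₂ : ∀ t : Fin 2 → ℤ, (∃ k : ℤ,
        h + R₀ + 3 ≤ (L₂ (zigVertexS step₂ k + ((t 0 : ℝ) • triangularVec₁ 1 + (t 1 : ℝ) • triangularVec₂ 1)) + s₂) 2 ∧
        (L₂ (zigVertexS step₂ k + ((t 0 : ℝ) • triangularVec₁ 1 + (t 1 : ℝ) • triangularVec₂ 1)) + s₂) 2 ≤ h + R₀ + 4 ∧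
        Real.sqrt ((L₂ (zigVertexS step₂ k + ((t 0 : ℝ) • triangularVec₁ 1 + (t 1 : ℝ) • triangularVec₂ 1)) + s₂) 0 ^ 2 +
          (L₂ (zigVertexS step₂ k + ((t 0 : ℝ) • triangularVec₁ 1 + (t 1 : ℝ) • triangularVec₂ 1)) + s₂) 1 ^ 2) ≤ ρ - m) →
        t ∈ T₂) :
    2 * ∑' ij : ℤ × ℤ, c ij.1 ij.2 * (volume (wallSlice ρ ∩ laySlab L₁ s₁ ij.1 ∩ laySlab L₂ s₂ ij.2)).toReal ≤
      (T₁.card : ℝ) + T₂.card + 80 * (R₀ + 9) * (1 + h) * ρ + 18 * m * ρ := by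
  have he₃ : ‖(e₃ : E3)‖ = 1 := by rw [e₃, PiLp.norm_single, norm_one]
  have hne₃ : ‖(-e₃ : E3)‖ = 1 := by rw [norm_neg, he₃]
  have hs2 : 0 ≤ Real.sqrt 2 := Real.sqrt_nonneg 2
  have hκ₁B : ∀ i, ⟪step₁ i, L₁.symm e₃⟫_ℝ ≤ 1 := fun i =>
    (real_inner_le_norm _ _).trans (by rw [(hup₁ i).norm_eq_one, LinearIsometryEquiv.norm_map, he₃, one_mul])
  have hκ₂B : ∀ j, ⟪step₂ j, L₂.symm (-e₃)⟫_ℝ ≤ 1 := fun j =>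
    (real_inner_le_norm _ _).trans (by rw [(hup₂ j).norm_eq_one, LinearIsometryEquiv.norm_map, hne₃, one_mul])
  have hcB : ∀ i j, c i j ≤ Real.sqrt 2 := fun i j => (hdom i j).trans (by
    have h1 : ⟪step₁ i, L₁.symm e₃⟫_ℝ + ⟪step₂ j, L₂.symm (-e₃)⟫_ℝ ≤ 2 := by linarith [hκ₁B i, hκ₂B j]
    nlinarith)
  set d : ℝ := 4 * h + 4 * R₀ + 36 with hd
  have hd0 : 0 ≤ d := by rw [hd]; linarith
  have hRh : 0 ≤ (R₀ + 9) * (1 + h) := mul_nonneg (by linarith) (by linarith)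
  have hdle : 18 * d * ρ ≤ 80 * (R₀ + 9) * (1 + h) * ρ := by
    have h1 : 18 * d ≤ 80 * (R₀ + 9) * (1 + h) := by rw [hd]; nlinarith
    nlinarith
  have hmain := two_charge_wallSlice_le_of_inner L₁ L₂ s₁ s₂ c hc0 hcB (ρ := ρ) (M := m + d) (N := (T₁.card : ℝ) + T₂.card) hρ
    (by linarith) (by positivity) (fun _ =>
      two_charge_le_lines_inner_up₂ hσ₁ hσ₂ L₁ L₂ s₁ s₂ R₀ h (ρ - (m + d)) hR₀ hh (by linarith) hax₁ hax₂ hup₁ hr₁ hup₂ hr₂ c hc0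
        hdom T₁ T₂ (fun t ⟨k, hk1, hk2, hk3⟩ => hT₁ t ⟨k, hk1, hk2, hk3.trans (by rw [hd]; linarith)⟩)
        (fun t ⟨k, hk1, hk2, hk3⟩ => hT₂ t ⟨k, hk1, hk2, hk3.trans (by rw [hd]; linarith)⟩))
  linarith

/-! ## The two-sided steered deliverable shape ⇒ the covered cell -/

/-- **Two-family line count along chosen steps ⇒ the covered cell inequality.**  For an `IsUpBond` step sequence on each plate (plate 1 up
along `e₃`, plate 2 up along `−e₃`, all rises `≥ 1/4`) and a nonnegative table dominated by half the TWO-SIDED flux sum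
`c i j ≤ √2·(⟪step₁ i, L₁⁻¹e₃⟫ + ⟪step₂ j, L₂⁻¹(−e₃)⟫)/2`, the two-family line-count shape (`m ≥ 0`, window line sets `T₁`, `T₂`,
`#T₁ + #T₂ + 18mρ ≤ PAY + C_w(1+h)ρ`) gives `BilayerWallAt ((C_w + 80(R₀+9) + 3456 + 1152(R₀+1))/2) R₀ σ₁ σ₂ L₁ L₂ s₁ s₂ c` (`R₀ ≥ 3`). -/
theorem bilayerWallAt_of_lineCount_up₂ {σ₁ σ₂ : ℤ → ℤ} (hσ₁ : IsHaggSeq σ₁) (hσ₂ : IsHaggSeq σ₂)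
    (L₁ L₂ : E3 ≃ₗᵢ[ℝ] E3) (s₁ s₂ : E3) (R₀ C_w : ℝ) (hR₀ : 3 ≤ R₀)
    (hax₁ : 0 ≤ (L₁.symm e₃) 2) (hax₂ : 0 ≤ (L₂.symm (-e₃)) 2)
    {step₁ : ℤ → E3} (hup₁ : ∀ k : ℤ, IsUpBond L₁ σ₁ e₃ k (step₁ k)) (hr₁ : ∀ k : ℤ, (1 / 4 : ℝ) ≤ ⟪step₁ k, L₁.symm e₃⟫_ℝ)
    {step₂ : ℤ → E3} (hup₂ : ∀ k : ℤ, IsUpBond L₂ σ₂ (-e₃) k (step₂ k)) (hr₂ : ∀ k : ℤ, (1 / 4 : ℝ) ≤ ⟪step₂ k, L₂.symm (-e₃)⟫_ℝ)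
    (c : ℤ → ℤ → ℝ) (hc0 : ∀ i j, 0 ≤ c i j)
    (hdom : ∀ i j, c i j ≤ Real.sqrt 2 * (⟪step₁ i, L₁.symm e₃⟫_ℝ + ⟪step₂ j, L₂.symm (-e₃)⟫_ℝ) / 2)
    (hF : ∀ h : ℝ, 0 ≤ h → ∀ ρ : ℝ, R₀ ≤ ρ → ∀ X P₁ P₂ : Finset E3,
      (∀ p ∈ X, ∀ q ∈ X, p ≠ q → 1 ≤ dist p q) → P₁ ⊆ X → P₂ ⊆ X \ P₁ → (∀ p ∈ X, p ∈ cyl R₀ h ρ) →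
      (∀ p, p ∈ P₁ ↔ (p ∈ stacking L₁ s₁ σ₁ ∧ -(2 * R₀) ≤ p 2 ∧ p 2 ≤ -R₀ ∧ p 0 ^ 2 + p 1 ^ 2 ≤ ρ ^ 2)) →
      (∀ p, p ∈ P₂ ↔ (p ∈ stacking L₂ s₂ σ₂ ∧ h + R₀ ≤ p 2 ∧ p 2 ≤ h + 2 * R₀ ∧ p 0 ^ 2 + p 1 ^ 2 ≤ ρ ^ 2)) →
      ∃ (m : ℝ) (T₁ T₂ : Finset (Fin 2 → ℤ)), 0 ≤ m ∧
        (∀ t : Fin 2 → ℤ, (∃ k : ℤ,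
          -R₀ - 4 ≤ (L₁ (zigVertexS step₁ k + ((t 0 : ℝ) • triangularVec₁ 1 + (t 1 : ℝ) • triangularVec₂ 1)) + s₁) 2 ∧
          (L₁ (zigVertexS step₁ k + ((t 0 : ℝ) • triangularVec₁ 1 + (t 1 : ℝ) • triangularVec₂ 1)) + s₁) 2 ≤ -R₀ - 3 ∧
          Real.sqrt ((L₁ (zigVertexS step₁ k + ((t 0 : ℝ) • triangularVec₁ 1 + (t 1 : ℝ) • triangularVec₂ 1)) + s₁) 0 ^ 2 +
            (L₁ (zigVertexS step₁ k + ((t 0 : ℝ) • triangularVec₁ 1 + (t 1 : ℝ) • triangularVec₂ 1)) + s₁) 1 ^ 2) ≤ ρ - m) →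
          t ∈ T₁) ∧
        (∀ t : Fin 2 → ℤ, (∃ k : ℤ,
          h + R₀ + 3 ≤ (L₂ (zigVertexS step₂ k + ((t 0 : ℝ) • triangularVec₁ 1 + (t 1 : ℝ) • triangularVec₂ 1)) + s₂) 2 ∧
          (L₂ (zigVertexS step₂ k + ((t 0 : ℝ) • triangularVec₁ 1 + (t 1 : ℝ) • triangularVec₂ 1)) + s₂) 2 ≤ h + R₀ + 4 ∧
          Real.sqrt ((L₂ (zigVertexS step₂ k + ((t 0 : ℝ) • triangularVec₁ 1 + (t 1 : ℝ) • triangularVec₂ 1)) + s₂) 0 ^ 2 +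
            (L₂ (zigVertexS step₂ k + ((t 0 : ℝ) • triangularVec₁ 1 + (t 1 : ℝ) • triangularVec₂ 1)) + s₂) 1 ^ 2) ≤ ρ - m) →
          t ∈ T₂) ∧
        (T₁.card : ℝ) + T₂.card + 18 * m * ρ ≤
          (∑ y ∈ X.filter (fun y => (X.filter fun q => dist y q = 1).card ≠ 12 ∧ -R₀ - 2 ≤ y 2 ∧ y 2 ≤ h + R₀ + 2),
            ((12 : ℝ) - ((X.filter fun q => dist y q = 1).card : ℝ))) + C_w * (1 + h) * ρ) :
    BilayerWallAt ((C_w + 80 * (R₀ + 9) + 3456 + 1152 * (R₀ + 1)) / 2) R₀ σ₁ σ₂ L₁ L₂ s₁ s₂ c := by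
  classical
  have hR₀1 : 1 ≤ R₀ := by linarith
  refine bilayerWallAt_of_payerBound hσ₁ hσ₂ L₁ L₂ s₁ s₂ R₀ (C_w + 80 * (R₀ + 9)) hR₀ c ?_
  intro h hh ρ hρ X P₁ P₂ hX hP₁X hP₂X hcell hP₁ hP₂
  obtain ⟨m, T₁, T₂, hm, hT₁, hT₂, hcount⟩ := hF h hh ρ hρ X P₁ P₂ hX hP₁X hP₂X hcell hP₁ hP₂
  have hρ0 : 0 ≤ ρ := by linarith
  have hcellbound := cell_charge_le_lines_margin_up₂ hσ₁ hσ₂ L₁ L₂ s₁ s₂ R₀ h ρ hR₀1 hh hρ0 hax₁ hax₂ hup₁ hr₁ hup₂ hr₂ c hc0 hdom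
    m hm T₁ T₂ hT₁ hT₂
  have hset : ({q : E3 | 0 ≤ q 2 ∧ q 2 ≤ 1 ∧ q 0 ^ 2 + q 1 ^ 2 ≤ ρ ^ 2} : Set E3) = wallSlice ρ := rfl
  rw [hset]
  have hsplit : (C_w + 80 * (R₀ + 9)) * (1 + h) * ρ = C_w * (1 + h) * ρ + 80 * (R₀ + 9) * (1 + h) * ρ := by ring
  rw [hsplit]
  linarith

end Summit.Ventures.Crystal3D.Theorems

end
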